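import Literature.AlgebraicGeometry.ModuliOfAbelianVarieties.SiegelAdmissibleOfLevelReading
import Literature.AlgebraicGeometry.ModuliOfAbelianVarieties.SiegelShimuraSet
import Literature.AlgebraicGeometry.ModuliOfAbelianVarieties.SiegelAdelicMarkingExists
import Literature.AlgebraicGeometry.ModuliOfAbelianVarieties.SiegelAdelicMarkingHoms
import Literature.AlgebraicGeometry.Motives.AbelianVarietyIsogenyFactorisationPoints
import Literature.AlgebraicGeometry.Motives.AbelianVarietyKernelDimension
import Literature.AlgebraicGeometry.Motives.AbelianVarietyFrobeniusCharpolyRigidity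
import Literature.AlgebraicGeometry.Motives.ComplexTorusIsogenyTransfer
import Literature.AlgebraicGeometry.HodgeTheory.IsoTransport
import Literature.Geometry.Kaehler.ComplexTorusTorsionSubgroup
import HarnessLib

/-!
# The marking of an isogeny QUOTIENT of a marked abelian variety (Hecke-link socket (β1) `QuotientMarking`)

Topic `AlgebraicGeometry/ModuliOfAbelianVarieties`; namespaces `Literature.AlgebraicGeometry.Motives.AbelianVariety` (§1)
and `Literature.AlgebraicGeometry.ModuliOfAbelianVarieties` (§§2–3).  THEOREMS ONLY (no definition, no named fact, no
instance, no `sorry`).  Cell `hodgecm-mathlib`, E-road / HECKE-LINK line card v1.1, socket (B) = (β) «the isogeny quotient at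
`s` is `(θZ, r)`-admissible» (B-p14 (g14) `BetaSockets.v1` f6fb2461), sub-socket **(β1) `QuotientMarking`** — B-plan1 (g14)
hand word 2026-08-29T19:59:28Z (a); road = B-p18 (g16) census 19:55:28Z.

SETTING ([Milne2005ShimuraVarieties] §6 Thm. 6.11 and p. 75; [Deligne1971TravauxShimura] 4.11–4.12): `A` a complex abelian
variety marked by `[J(Z), r′]` (★ `SiegelAdelicMarking`: uniformisation `ℂ^g/Ψ(ℤ^{2g}) → A(ℂ)`, torsion parametrisation
`u = m.r : V = ℚ^{2g} → A(ℂ)` with kernel `Λ_{r′}`), `ψ : A ⟶ B` a homomorphism ONTO `B` (on ℂ-points), `dim B = g`, whose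
kernel is the `u`-image of the lattice `γq⁻¹Λ_r` (`ψ(u(v)) = 1 ↔ γq·v ∈ Λ_r`), for a rational similitude `γq` with
`J(θZ) = γq J(Z) γq⁻¹` and `γq Λ_{r′} ⊆ Λ_r`.  CLAIM (β1): `B` is marked by `[J(θZ), r]` with torsion parametrisation
`u_B(v) = ψ(u(γq⁻¹ v))`.

ROAD (all inputs ★ by name): a basis matrix `γ_B` of `Λ_r` (★ `exists_isLatticeBasis`); SOME abelian variety `A″` marked by
`[J(θZ), r]` (★ `SiegelAdelicMarking.exists`, Lange 7.1.5 + Lefschetz–Chow–GAGA); the homomorphism `h : A ⟶ A″` induced by `γq`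
(★ `SiegelAdelicMarking.exists_hom_forall_map_r_eq_of_forall_mem`: `h(u(v)) = u″(γq v)`); `h` is ONTO (its image is compact and
contains the dense torsion `u″(V)`) hence an isogeny, as is `ψ` (★ `isIsogeny_of_surjective_of_dim_eq`); `h` and `ψ` have the
SAME kernel on ℂ-points (both kernels are torsion, read through `u`), so by unique factorisation through an isogeny (★
`IsIsogeny.existsUnique_comp_eq_of_forall_map_eq_one`, [MumfordAV1970] §19 Remark (p. 172) / §7 Thm. 4) they differ by an
ISOMORPHISM `e : A″ ≅ B`, `h ≫ e = ψ` (§1, `exists_iso_comp_eq_of_map_eq_one_iff`); the marking of `A″` transported along `e`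
(★ `IsAnalytification.transport_iso`) marks `B`, and `u_B(v) = e(u″(v)) = e(h(u(γq⁻¹v))) = ψ(u(γq⁻¹ v))`.

* §1 `AbelianVariety.exists_iso_comp_eq_of_map_eq_one_iff` — **two isogenies out of `A` with the same kernel on `ℂ`-points
  differ by an isomorphism of their targets** (categorical quotients are unique; [MumfordAV1970] §7 Thm. 4 p. 72, §19 Remark
  (p. 172); [Milne1986AbelianVarieties] §8 Rem. 8.12).
* §2 `SiegelAdelicMarking.exists_r_eq_of_isIsogeny_of_map_eq_one` (a point killed by an isogeny is a `u(v)`),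
  `SiegelAdelicMarking.denseRange_r` (`u(V)` is dense in `A(ℂ)`), `SiegelAdelicMarking.surjective_map_of_forall_map_r_eq` (a
  homomorphism `h` between marked varieties reading `h(u(v)) = u″(q v)`, `q` invertible, is onto on ℂ-points).
* §3 **`SiegelAdelicMarking.exists_quotientMarking`** — the (β1) statement, binders = B-p14's socket text `QuotientMarking` verbatim.

## References

* [Milne2005ShimuraVarieties] J. S. Milne, *Introduction to Shimura varieties* (2005), §6 Thm. 6.11 p. 74 and p. 75.
* [Deligne1971TravauxShimura] P. Deligne, *Travaux de Shimura*, Sém. Bourbaki 389 (1971), 4.11–4.12 pp. 148–149.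
* [MumfordAV1970] D. Mumford, *Abelian Varieties* (1970), §7 Thm. 4 (p. 72), §19 Remark (p. 172).
* [Milne1986AbelianVarieties] J. S. Milne, *Abelian Varieties* (in Cornell–Silverman 1986), §8 Rem. 8.12.

#harness_tags algebraic_geometry.abelian_varieties, number_theory.shimura_varieties
-/

set_option autoImplicit false

noncomputable section

open CategoryTheory AlgebraicGeometry Matrix
open Literature.AlgebraicGeometry.Motives (SchemeOver ComplexPoints AlgPoints specOver AbelianVariety)
open Literature.Geometry.Kaehler (ComplexTorus)
open Literature.NumberTheory.Transcendental (IsAnalytification)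
open Literature.NumberTheory.Automorphic (siegelUpperHalfSpace)
open Literature.NumberTheory.Adeles (latticeOfGL)

/-! ## §1 Two isogenies with the same kernel differ by an isomorphism -/

namespace Literature.AlgebraicGeometry.Motives.AbelianVariety

/-- **Two isogenies out of `A` with the same kernel on `ℂ`-points differ by an isomorphism of their targets**: for isogenies
`h : A ⟶ B`, `ψ : A ⟶ C` of complex abelian varieties with `h(P) = 1 ↔ ψ(P) = 1` for every `P ∈ A(ℂ)`, there is an
isomorphism `e : B ≅ C` of abelian varieties with `h ≫ e = ψ` — each factors uniquely through the other (★
`IsIsogeny.existsUnique_comp_eq_of_forall_map_eq_one`, Mumford §19 Remark / §7 Thm. 4: an isogeny is the categorical quotient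
by its kernel), and the two factorisations are mutually inverse by uniqueness. [cite: MumfordAV1970, §7 Thm. 4 (p. 72) and §19 Remark (p. 172)]
[cite: Milne1986AbelianVarieties, §8 Rem. 8.12] -/
theorem exists_iso_comp_eq_of_map_eq_one_iff {A B C : AbelianVariety ℂ} {h : A ⟶ B} {ψ : A ⟶ C}
    (hh : IsIsogeny h) (hψ : IsIsogeny ψ)
    (hker : ∀ P : A.Points ℂ, AlgPoints.map h.hom.hom.hom P = 1 ↔ AlgPoints.map ψ.hom.hom.hom P = 1) :
    ∃ e : B ≅ C, h ≫ e.hom = ψ := by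
  obtain ⟨g, hg, -⟩ := hh.existsUnique_comp_eq_of_forall_map_eq_one ℂ ψ fun P hP ↦ (hker P).1 hP
  obtain ⟨g', hg', -⟩ := hψ.existsUnique_comp_eq_of_forall_map_eq_one ℂ h fun P hP ↦ (hker P).2 hP
  obtain ⟨i, -, hiu⟩ := hh.existsUnique_comp_eq_of_forall_map_eq_one ℂ h fun P hP ↦ hP
  obtain ⟨i', -, hiu'⟩ := hψ.existsUnique_comp_eq_of_forall_map_eq_one ℂ ψ fun P hP ↦ hP
  have h1 : g ≫ g' = 𝟙 B := by
    have e1 : h ≫ (g ≫ g') = h := by rw [← Category.assoc, hg, hg']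
    rw [hiu _ e1, hiu _ (Category.comp_id h)]
  have h2 : g' ≫ g = 𝟙 C := by
    have e1 : ψ ≫ (g' ≫ g) = ψ := by rw [← Category.assoc, hg', hg]
    rw [hiu' _ e1, hiu' _ (Category.comp_id ψ)]
  exact ⟨⟨g, g', h1, h2⟩, hg⟩

end Literature.AlgebraicGeometry.Motives.AbelianVariety

/-! ## §2 Marked varieties: torsion points, density of `u(V)`, surjectivity of lattice-induced homomorphisms -/

namespace Literature.AlgebraicGeometry.ModuliOfAbelianVarieties

open SiegelModuli
open Literature.AlgebraicGeometry.Motives.AbelianVariety (IsIsogeny)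

variable {g : ℕ} {δ : Fin g → ℕ} {J J' : C0pm δ} {a a' : gspFinAdelic δ} {A A' B : AbelianVariety ℂ}

/-- **A point killed by an isogeny is a `u(v)`**: the kernel of an isogeny is finite on ℂ-points (★ `finite_kerPoints_of_isFinite`),
so its points are torsion, and the torsion of a marked `A` is `u(V)` (★ `exists_r_eq_of_zpow_eq_one`).
[cite: Milne2005ShimuraVarieties, §6 Thm. 6.11 p. 74] [cite: MumfordAV1970, §7 Thm. 4 (p. 72)] -/
theorem SiegelAdelicMarking.exists_r_eq_of_isIsogeny_of_map_eq_one (m : SiegelAdelicMarking J a A) {f : A ⟶ B}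
    (hf : IsIsogeny f) {P : A.Points ℂ} (hP : AlgPoints.map f.hom.hom.hom P = 1) : ∃ v : Fin g ⊕ Fin g → ℚ, m.r v = P := by
  haveI := hf.2
  haveI : Finite (AbelianVariety.Hom.kerPoints (specOver ℂ ℂ) f) := AbelianVariety.finite_kerPoints_of_isFinite f ℂ
  have hmem : P ∈ AbelianVariety.Hom.kerPoints (specOver ℂ ℂ) f := (AbelianVariety.Hom.mem_kerPoints_iff f P).2 hP
  have hpow : (⟨P, hmem⟩ : AbelianVariety.Hom.kerPoints (specOver ℂ ℂ) f) ^
      Nat.card (AbelianVariety.Hom.kerPoints (specOver ℂ ℂ) f) = 1 := pow_card_eq_one'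
  have hpow' : P ^ (Nat.card (AbelianVariety.Hom.kerPoints (specOver ℂ ℂ) f) : ℤ) = 1 := by
    rw [zpow_natCast]
    exact congrArg Subtype.val hpow
  exact m.exists_r_eq_of_zpow_eq_one (Int.natCast_ne_zero.2 Nat.card_pos.ne') hpow'

/-- **`u(V)` is dense in `A(ℂ)`** (the rational points of the torus are dense, ★ `ComplexTorus.denseRange_proj_ratCast`, and the
uniformisation is a homeomorphism). [cite: Milne2005ShimuraVarieties, §6 Thm. 6.11 p. 74] -/
theorem SiegelAdelicMarking.denseRange_r (m : SiegelAdelicMarking J a A) : DenseRange m.r := by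
  -- `r = toFun ∘ proj ∘ ratCast ∘ (γ⁻¹ ·)`, and `γ⁻¹ ·` is onto `ℚ^{2g}`
  have h1 : DenseRange (fun q : Fin g ⊕ Fin g → ℚ ↦ ComplexTorus.proj m.Ψ fun i ↦ ((q i : ℚ) : ℝ)) :=
    ComplexTorus.denseRange_proj_ratCast m.Ψ
  have h2 : DenseRange (fun v : Fin g ⊕ Fin g → ℚ ↦ ComplexTorus.proj m.Ψ fun i ↦
      (((((m.γ⁻¹ : GL (Fin g ⊕ Fin g) ℚ) : Matrix (Fin g ⊕ Fin g) (Fin g ⊕ Fin g) ℚ) *ᵥ v) i : ℚ) : ℝ)) := by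
    have hsurj : Function.Surjective (fun v : Fin g ⊕ Fin g → ℚ ↦
        ((m.γ⁻¹ : GL (Fin g ⊕ Fin g) ℚ) : Matrix (Fin g ⊕ Fin g) (Fin g ⊕ Fin g) ℚ) *ᵥ v) := fun w ↦
      ⟨((m.γ : GL (Fin g ⊕ Fin g) ℚ) : Matrix (Fin g ⊕ Fin g) (Fin g ⊕ Fin g) ℚ) *ᵥ w, by
        simp only [Matrix.mulVec_mulVec, ← Units.val_mul, inv_mul_cancel, Units.val_one, Matrix.one_mulVec]⟩
    change DenseRange ((fun q : Fin g ⊕ Fin g → ℚ ↦ ComplexTorus.proj m.Ψ fun i ↦ ((q i : ℚ) : ℝ)) ∘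
      fun v : Fin g ⊕ Fin g → ℚ ↦ ((m.γ⁻¹ : GL (Fin g ⊕ Fin g) ℚ) : Matrix (Fin g ⊕ Fin g) (Fin g ⊕ Fin g) ℚ) *ᵥ v)
    rw [DenseRange, hsurj.range_comp]
    exact h1
  have h3 : DenseRange (m.toFun ∘ fun v : Fin g ⊕ Fin g → ℚ ↦ ComplexTorus.proj m.Ψ fun i ↦
      (((((m.γ⁻¹ : GL (Fin g ⊕ Fin g) ℚ) : Matrix (Fin g ⊕ Fin g) (Fin g ⊕ Fin g) ℚ) *ᵥ v) i : ℚ) : ℝ)) :=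
    m.isAnalytification.isHomeomorph.surjective.denseRange.comp h2 m.isAnalytification.isHomeomorph.continuous
  exact h3

/-- **A homomorphism between marked varieties that reads `h(u(v)) = u′(q v)` for an INVERTIBLE rational `q` is onto on
ℂ-points**: its image is compact (the source is a compact torus), hence closed, and contains the dense set `u′(V)`.
[cite: Milne2005ShimuraVarieties, §6 Thm. 6.11 p. 74 and p. 75] -/
theorem SiegelAdelicMarking.surjective_map_of_forall_map_r_eq (m : SiegelAdelicMarking J a A) (m' : SiegelAdelicMarking J' a' A')
    (q : GL (Fin g ⊕ Fin g) ℚ) (h : A ⟶ A')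
    (hh : ∀ v : Fin g ⊕ Fin g → ℚ, AlgPoints.map h.hom.hom.hom (m.r v) =
      m'.r (((q : GL (Fin g ⊕ Fin g) ℚ) : Matrix (Fin g ⊕ Fin g) (Fin g ⊕ Fin g) ℚ) *ᵥ v)) :
    Function.Surjective (AlgPoints.map (L := ℂ) h.hom.hom.hom) := by
  haveI : CompactSpace (A.Points ℂ) := m.isAnalytification.isHomeomorph.surjective.compactSpace
    m.isAnalytification.isHomeomorph.continuous
  haveI : T2Space (A'.Points ℂ) := (m'.isAnalytification.isHomeomorph.homeomorph _).t2Space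
  have hcont : Continuous (AlgPoints.map (L := ℂ) h.hom.hom.hom) := AlgPoints.continuous_map _
  have hclosed : IsClosed (Set.range (AlgPoints.map (L := ℂ) h.hom.hom.hom)) :=
    (isCompact_range hcont).isClosed
  -- the image contains `u′(V)`, which is dense
  have hsub : Set.range m'.r ⊆ Set.range (AlgPoints.map (L := ℂ) h.hom.hom.hom) := by
    rintro _ ⟨v, rfl⟩
    refine ⟨m.r (((q⁻¹ : GL (Fin g ⊕ Fin g) ℚ) : Matrix (Fin g ⊕ Fin g) (Fin g ⊕ Fin g) ℚ) *ᵥ v), ?_⟩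
    rw [hh, Matrix.mulVec_mulVec, ← Units.val_mul, mul_inv_cancel, Units.val_one, Matrix.one_mulVec]
  have hdense : Dense (Set.range (AlgPoints.map (L := ℂ) h.hom.hom.hom)) :=
    m'.denseRange_r.mono hsub
  exact Set.range_eq_univ.1 (hdense.closure_eq ▸ hclosed.closure_eq.symm ▸ rfl)

/-! ## §3 (β1): the marking of the isogeny quotient -/

/-- **(β1) «MARKING OF AN ISOGENY QUOTIENT»** (socket text of B-p14 (g14)'s `QuotientMarking`, binders verbatim): if the complex
abelian variety `A` is marked by `[J(Z), r′]` (`m`), `ψ : A → B` is a homomorphism onto `B` (on ℂ-points) whose kernel is the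
`m`-image of the lattice `γq⁻¹Λ_r` (`ψ(u(v)) = 1 ↔ γq v ∈ Λ_r`), `dim B = g`, and `J(θZ) = γq J(Z) γq⁻¹` with (QA1) (and (QA3),
unused here), then `B` is marked by `[J(θZ), r]` with torsion parametrisation `u_B(v) = ψ(u(γq⁻¹ v))` — transport of the marking of
an auxiliary marked model `A″` of `[J(θZ), r]` (★ `SiegelAdelicMarking.exists`) along the isomorphism `A″ ≅ B` comparing the two
isogenies `A → A″` (induced by `γq`, ★ `exists_hom_forall_map_r_eq_of_forall_mem`) and `ψ` with the same kernel (§1).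
[cite: Milne2005ShimuraVarieties, §6 Thm. 6.11 p. 74 and p. 75] [cite: Deligne1971TravauxShimura, 4.11–4.12 pp. 148–149]
[cite: MumfordAV1970, §7 Thm. 4 (p. 72) and §19 Remark (p. 172)] -/
theorem SiegelAdelicMarking.exists_quotientMarking {g : ℕ} {δ : Fin g → ℕ} (hδ : IsPolarizationType δ)
    (Z : Matrix (Fin g) (Fin g) ℂ) (hZ : Z ∈ siegelUpperHalfSpace g) (Z' : Matrix (Fin g) (Fin g) ℂ)
    (hZ' : Z' ∈ siegelUpperHalfSpace g) (r r' : gspFinAdelic δ) (γq : GL (Fin g ⊕ Fin g) ℚ)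
    (hJ : jOfSiegel δ Z' = conjJ (Matrix.GeneralLinearGroup.map (algebraMap ℚ ℝ) γq) (jOfSiegel δ Z))
    (hQA1 : ∀ v : Fin g ⊕ Fin g → ℚ, v ∈ latticeOfGL (r' : GL (Fin g ⊕ Fin g) finAdeleQ) →
      (γq : Matrix (Fin g ⊕ Fin g) (Fin g ⊕ Fin g) ℚ) *ᵥ v ∈ latticeOfGL (r : GL (Fin g ⊕ Fin g) finAdeleQ))
    (_hQA3 : ∃ ν : ℚ, 0 < ν ∧ (γq : Matrix (Fin g ⊕ Fin g) (Fin g ⊕ Fin g) ℚ)ᵀ * typeFormOver δ ℚ *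
      (γq : Matrix (Fin g ⊕ Fin g) (Fin g ⊕ Fin g) ℚ) = ν • typeFormOver δ ℚ)
    (A B : AbelianVariety ℂ)
    (m : SiegelAdelicMarking ⟨jOfSiegel δ Z, SiegelComplexRecordSystem.jOfSiegel_mem_C0pm hδ.1 hZ⟩ r' A)
    (ψ : A ⟶ B) (hdim : B.dim = g)
    (hker : ∀ v : Fin g ⊕ Fin g → ℚ, AlgPoints.map ψ.hom.hom.hom (m.r v) = 1 ↔
      (γq : Matrix (Fin g ⊕ Fin g) (Fin g ⊕ Fin g) ℚ) *ᵥ v ∈ latticeOfGL (r : GL (Fin g ⊕ Fin g) finAdeleQ))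
    (hsurj : Function.Surjective (AlgPoints.map (L := ℂ) ψ.hom.hom.hom : A.Points ℂ → B.Points ℂ)) :
    ∃ mB : SiegelAdelicMarking ⟨jOfSiegel δ Z', SiegelComplexRecordSystem.jOfSiegel_mem_C0pm hδ.1 hZ'⟩ r B,
      ∀ v : Fin g ⊕ Fin g → ℚ, mB.r v = AlgPoints.map ψ.hom.hom.hom
        (m.r ((((γq⁻¹ : GL (Fin g ⊕ Fin g) ℚ) : Matrix (Fin g ⊕ Fin g) (Fin g ⊕ Fin g) ℚ)) *ᵥ v)) := by
  -- (1)–(2): an auxiliary marked model `A″` of the target point `[J(θZ), r]`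
  obtain ⟨γB, hγB⟩ := exists_isLatticeBasis r
  obtain ⟨A'', ⟨m''⟩⟩ := SiegelAdelicMarking.exists
    (⟨jOfSiegel δ Z', SiegelComplexRecordSystem.jOfSiegel_mem_C0pm hδ.1 hZ'⟩ : C0pm δ) r γB hγB
  -- (3): the homomorphism `h : A ⟶ A″` induced by `γq` (`ℂ`-linear for `J(Z)`, `J(θZ)`; lattice-compatible by (QA1))
  have hM : ((Matrix.GeneralLinearGroup.map (algebraMap ℚ ℝ) γq : GL (Fin g ⊕ Fin g) ℝ) :
      Matrix (Fin g ⊕ Fin g) (Fin g ⊕ Fin g) ℝ) =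
        ((γq : GL (Fin g ⊕ Fin g) ℚ) : Matrix (Fin g ⊕ Fin g) (Fin g ⊕ Fin g) ℚ).map (algebraMap ℚ ℝ) := rfl
  have hqJ : ((γq : GL (Fin g ⊕ Fin g) ℚ) : Matrix (Fin g ⊕ Fin g) (Fin g ⊕ Fin g) ℚ).map (algebraMap ℚ ℝ) *
      ((⟨jOfSiegel δ Z, SiegelComplexRecordSystem.jOfSiegel_mem_C0pm hδ.1 hZ⟩ : C0pm δ) :
        Matrix (Fin g ⊕ Fin g) (Fin g ⊕ Fin g) ℝ) =
      ((⟨jOfSiegel δ Z', SiegelComplexRecordSystem.jOfSiegel_mem_C0pm hδ.1 hZ'⟩ : C0pm δ) :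
        Matrix (Fin g ⊕ Fin g) (Fin g ⊕ Fin g) ℝ) *
        ((γq : GL (Fin g ⊕ Fin g) ℚ) : Matrix (Fin g ⊕ Fin g) (Fin g ⊕ Fin g) ℚ).map (algebraMap ℚ ℝ) := by
    change _ * jOfSiegel δ Z = jOfSiegel δ Z' * _
    rw [hJ, conjJ_def, ← hM, Matrix.mul_assoc, Units.inv_mul, Matrix.mul_one]
  obtain ⟨h, hh⟩ := m.exists_hom_forall_map_r_eq_of_forall_mem m''
    ((γq : GL (Fin g ⊕ Fin g) ℚ) : Matrix (Fin g ⊕ Fin g) (Fin g ⊕ Fin g) ℚ) hqJ hQA1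
  -- (4): `h` and `ψ` are isogenies with the same kernel on ℂ-points
  have hAg : A.dim = g := m.dim_eq
  have hA''g : A''.dim = g := m''.dim_eq
  have hhsurj : Function.Surjective (AlgPoints.map (L := ℂ) h.hom.hom.hom) :=
    m.surjective_map_of_forall_map_r_eq m'' γq h hh
  have hiso_h : IsIsogeny h := by
    haveI : Surjective (AbelianVariety.Hom.toSchemeHom h) :=
      (AbelianVariety.surjective_toSchemeHom_iff_map_surjective h).2 hhsurj
    exact AbelianVariety.isIsogeny_of_surjective_of_dim_eq h (hAg.trans hA''g.symm)
  have hiso_ψ : IsIsogeny ψ := by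
    haveI : Surjective (AbelianVariety.Hom.toSchemeHom ψ) :=
      (AbelianVariety.surjective_toSchemeHom_iff_map_surjective ψ).2 hsurj
    exact AbelianVariety.isIsogeny_of_surjective_of_dim_eq ψ (hAg.trans hdim.symm)
  have hker' : ∀ P : A.Points ℂ, AlgPoints.map h.hom.hom.hom P = 1 ↔ AlgPoints.map ψ.hom.hom.hom P = 1 := by
    intro P
    constructor
    · intro hP
      obtain ⟨v, rfl⟩ := m.exists_r_eq_of_isIsogeny_of_map_eq_one hiso_h hP
      rw [hh, m''.r_eq_one_iff_mem_latticeOfGL] at hP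
      exact (hker v).2 hP
    · intro hP
      obtain ⟨v, rfl⟩ := m.exists_r_eq_of_isIsogeny_of_map_eq_one hiso_ψ hP
      rw [hh, m''.r_eq_one_iff_mem_latticeOfGL]
      exact (hker v).1 hP
  -- (5): the two quotients differ by an isomorphism `e : A″ ≅ B` with `h ≫ e = ψ`
  obtain ⟨e, he⟩ := AbelianVariety.exists_iso_comp_eq_of_map_eq_one_iff hiso_h hiso_ψ hker'
  let e' : A''.X ≅ B.X :=
    { hom := e.hom.hom.hom.hom
      inv := e.inv.hom.hom.hom
      hom_inv_id := by
        change (e.hom ≫ e.inv).hom.hom.hom = (𝟙 A'' : A'' ⟶ A'').hom.hom.hom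
        rw [e.hom_inv_id]
      inv_hom_id := by
        change (e.inv ≫ e.hom).hom.hom.hom = (𝟙 B : B ⟶ B).hom.hom.hom
        rw [e.inv_hom_id] }
  have he' : h.hom.hom.hom ≫ e'.hom = ψ.hom.hom.hom := by
    change (h ≫ e.hom).hom.hom.hom = _
    rw [he]
  have hBA'' : B.dim = A''.dim := hdim.trans hA''g.symm
  -- (6): transport the marking of `A″` along `e`
  refine ⟨{ γ := m''.γ
            γ_isLatticeBasis := m''.γ_isLatticeBasis
            Ψ := m''.Ψ
            Ψ_J := m''.Ψ_J
            toFun := AlgPoints.map e'.hom ∘ m''.toFun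
            isAnalytification := by
              rw [hBA'']
              exact m''.isAnalytification.transport_iso e'
            toFun_add := fun x y ↦ by
              rw [Function.comp_apply, Function.comp_apply, Function.comp_apply, m''.toFun_add, AlgPoints.map_apply,
                AlgPoints.map_apply, AlgPoints.map_apply]
              exact MonObj.mul_comp _ _ _ }, fun v ↦ ?_⟩
  -- `u_B(v) = e(u″(v)) = e(h(u(γq⁻¹ v))) = ψ(u(γq⁻¹ v))`
  have hv : m''.r v = AlgPoints.map h.hom.hom.hom
      (m.r ((((γq⁻¹ : GL (Fin g ⊕ Fin g) ℚ) : Matrix (Fin g ⊕ Fin g) (Fin g ⊕ Fin g) ℚ)) *ᵥ v)) := by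
    rw [hh, Matrix.mulVec_mulVec, ← Units.val_mul, mul_inv_cancel, Units.val_one, Matrix.one_mulVec]
  change AlgPoints.map e'.hom (m''.r v) = _
  rw [hv, ← AlgPoints.map_comp_apply, he']

end Literature.AlgebraicGeometry.ModuliOfAbelianVarieties

end
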